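import Summits.BirchSwinnertonDyer.Rank1Residual.O6.X3KatoMemberBound
import HarnessLib

/-!
# O6 / X3, rank 0: READINGS of Kato's member bound T-X3K / T-X3K♯ at the X3-wild slot — theorems only
(cell `b2b-bsdres`, lane CLASS-CLOSURE, class O6 §3.4 ∩ X3; planner o6-r1 GEN 21, memo `HOME/b2b-bsdres-o6-r1/gen21/O6-GEN21.md`
 (sha16 `4924ab07e53b1f04`) §2 REACH / §4; typer of record cc-typer-5 GEN 15; sibling of the node file `O6/X3KatoMemberBound.lean`
 (T-X3K `KatoMemberShaBoundOfReducible`, T-X3K♯ `X3PotGoodRankZeroUpperOfSmallClassTorsion`, the PROVED kernel route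
 `x3PotGoodRankZeroUpperOfSmallClassTorsion_of_katoMember`), split off for `lint.size`.  THEOREMS ONLY: no definition, no node,
 no Literature fact; every node enters as a displayed hypothesis `(hS : …)` / `(hK : …)`; nothing is asserted about any node.)

HONEST FRAMING (cell `b2b-bsdres`, run/shared/lean/b2b/bsd-rank1-residual/, verbatim in every file): the goal of the cell is
to DELETE the COMBINATION-SHAPED residual classes of the Birch–Swinnerton-Dyer formula for ALL analytic-rank `≤ 1` elliptic
curves over `ℚ` — "full BSD formula for every rank `≤ 1` curve in class `C`" assembled STRICTLY from published theorems — so that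
the rank-`≤ 1` remainder becomes exactly the CONSTRUCTION-SHAPED classes, which are TYPED (missing-input `Prop`s), NOT attempted.
This is not "finishing BSD". Lane CLASS-CLOSURE: research routes; census output is EVIDENCE / conjecture items, never a Literature
fact; no main conjecture inside any certificate; nothing is booked; no mark of `RESIDUAL-MAP.md` moves; O6 and X3 stay OPEN.

WHAT IS PROVED (the X3-wild slot = `ClassX3 W 3 ∧ SubW W 3`, the binders of `O6Targets`' KMC-shaped `X3WildOfKMC`; for `r_an = 0`
these readings REPLACE that slot — no main conjecture is an input, o6-r1 GEN 21 ask (b)):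
* `X3WildRankZero.missingUpperBoundAt_of_smallClassTorsion` — T-X3K♯ (`hS`) ⟹ `MissingUpperBoundAt W 3` on X3-wild r0 rows with no
  `ℤ/9` in the class and `ord₃ #Ш_an(W)` even;
* `X3WildRankZero.missingUpperBoundAt_of_katoMember` — the same from T-X3K (`hK`) through the node file's proved kernel route, granted
  Cassels (`hCassels`), Cassels–Tate (`hCT`), GZK (`hGZK`), modularity (`hmod`);
* `X3WildRankZero.bsdp_of_isIsogenous_of_unit_member` — **full `BSD(W,p)` for EVERY member of a class having a member `W₀` with
  `p ∤ #Ш_an(W₀)`** (memo §2 REACH: 9 329 / 9 476 X3∧O6∧r0 classes at `p = 3`): lower half trivial at `W₀`, T-X3K♯ upper half, Miller's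
  `BSD(E,p)` transported along the isogeny by Cassels (`TwistComparison.bsdp_of_bsdp_of_isIsogenous`);
* `X3WildRankZero.bsdp_of_isIsogenous_of_certificate` — **full `BSD(W,p)` from a finite LOWER certificate `p^{2k−1} ∣ #Ш(W₀)`,
  `ord_p #Ш_an(W₀) ≤ 2k`** (the 144 all-`9 ∣ #Ш_an` classes; census ask C-X3K-3, o6-r2's side; socket = `Typed/CasselsLowerBound`'s
  `missingLowerBoundAt_of_casselsTate_of_pow_dvd`); the certificate is per curve.
Reused by name: `ClassX3` (`Red ∧ Addv`), `SubW` (`¬PotMult ∧ ¬CondExpTwo`), `MissingUpperBoundAt`, `MissingLowerBoundAt`,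
`MissingPPartAt`, `BSDp`, `bsdp_of_missingPPartAt`, `missingPPartAt_of_lower_of_upper`, `TwistComparison.bsdp_of_bsdp_of_isIsogenous`,
`missingLowerBoundAt_of_casselsTate_of_pow_dvd`.  EVIDENCE of record: as in the node file (o6-r1 GEN 21 C-X3K-0 / C-X3K-2).
References: J. W. S. Cassels, J. reine angew. Math. 217 (1965) [Cassels1965ArithmeticVIII]; J. S. Milne, ADT Thm. I.7.3 [MilneADT2006];
J. H. Silverman, AEC Thm. X.4.14 [SilvermanAEC2009]; R. L. Miller, LMS J. Comput. Math. 14 (2011) §1, Def. 1.1 [Miller2011LMS];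
H. Darmon, CBMS 101 (2004) Thm. 3.22 [Darmon2004]; K. Kato, Astérisque 295 (2004) Thm. 12.6 [Kato2004Asterisque].
-/

set_option autoImplicit false

noncomputable section

open scoped Classical

open WeierstrassCurve Literature.NumberTheory.EllipticCurves
  Literature.NumberTheory.EllipticCurves.Rank1Residual
  Literature.NumberTheory.EllipticCurves.Rank1Residual.Typed
  Summit.BirchSwinnertonDyer.Rank1Residual.Additive

namespace Summit.BirchSwinnertonDyer.Rank1Residual.O6

/-! ## READINGS at the X3-wild slot (`ClassX3 W 3 ∧ SubW W 3` = X3 ∧ O6, the binders of `O6Targets`' `X3WildOfKMC`):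
for `r_an = 0` these REPLACE the KMC-shaped slot — no main conjecture is an input. -/

/-- **T-X3K♯ at the X3-wild slot (r0):** for `W` globally minimal with `ClassX3 W 3` (additive at `3`, `W[3]` reducible) and
`SubW W 3` (potentially good, wild), `r_an = 0`, no `ℤ/9` in the isogeny class and `ord₃ #Ш_an(W)` even, the UPPER half
`MissingUpperBoundAt W 3` — granted the node T-X3K♯ (`hS`).  Bookkeeping (`ClassX3 = Red ∧ Addv`, `SubW.1 = ¬PotMult` gives
`0 ≤ v₃(j)`). [folklore] -/
theorem X3WildRankZero.missingUpperBoundAt_of_smallClassTorsion (hS : X3PotGoodRankZeroUpperOfSmallClassTorsion)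
    (W : WeierstrassCurve ℚ) [W.IsElliptic] [W.IsGloballyMinimal] (hX : ClassX3 W 3) (hW : SubW W 3)
    (hr : W.analyticRank = 0)
    (hsmall : ∀ (W' : WeierstrassCurve ℚ) [W'.IsElliptic], IsIsogenous W W' → ¬ 3 ^ 2 ∣ W'.torsionOrder)
    (heven : ∀ q : ℚ, shaAn W = (q : ℂ) → Even (padicValRat 3 q)) : MissingUpperBoundAt W 3 :=
  hS W 3 (by decide) hX.2.1 hX.2.2 (not_lt.mp hW.1) hX.1 hr hsmall heven

/-- **T-X3K at the X3-wild slot (r0), through the proved kernel route:** the same conclusion granted Kato's member bound T-X3K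
(`hK`) and the published facts Cassels (`hCassels`), Cassels–Tate (`hCT`), GZK (`hGZK`), modularity (`hmod`).
[cite: Cassels1965ArithmeticVIII] [cite: SilvermanAEC2009, Thm. X.4.14] [cite: Miller2011LMS, §1 and Def. 1.1] -/
theorem X3WildRankZero.missingUpperBoundAt_of_katoMember (hK : KatoMemberShaBoundOfReducible)
    (hCassels : bsdRHS_eq_of_isIsogenous) (hCT : exists_casselsTate_pairing (K := ℚ))
    (hGZK : rank_eq_analyticRank_of_analyticRank_le_one) (hmod : hasEntireLFunction_rat)
    (W : WeierstrassCurve ℚ) [W.IsElliptic] [W.IsGloballyMinimal] (hX : ClassX3 W 3) (hW : SubW W 3)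
    (hr : W.analyticRank = 0)
    (hsmall : ∀ (W' : WeierstrassCurve ℚ) [W'.IsElliptic], IsIsogenous W W' → ¬ 3 ^ 2 ∣ W'.torsionOrder)
    (heven : ∀ q : ℚ, shaAn W = (q : ℂ) → Even (padicValRat 3 q)) : MissingUpperBoundAt W 3 :=
  X3WildRankZero.missingUpperBoundAt_of_smallClassTorsion
    (x3PotGoodRankZeroUpperOfSmallClassTorsion_of_katoMember hK hCassels hCT hGZK hmod) W hX hW hr hsmall heven

/-- **Full `BSD(W,p)` on the whole class from ONE member with `p ∤ #Ш_an` (memo §2 REACH: 9 329 of 9 476 X3∧O6∧r0 classes at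
`p = 3`).**  If `W₀` satisfies the hypotheses of T-X3K♯ (odd additive potentially good `p`, `W₀[p]` reducible, `r_an = 0`, no
`ℤ/p²` in the class) and `#Ш_an(W₀) = q₀ ∈ ℚ` with `ord_p q₀ = 0`, then `BSDp W p` for EVERY globally minimal `W` isogenous to
`W₀`: at `W₀` the parity hypothesis is trivial (`0` is even), the upper half is T-X3K♯ (`hS`), the lower half is free
(`0 ≤ ord_p #Ш`), so `MissingPPartAt W₀ p`, hence `BSDp W₀ p` (`bsdp_of_missingPPartAt`, GZK), transported along the isogeny by
Cassels (`TwistComparison.bsdp_of_bsdp_of_isIsogenous`).  Nothing is asserted about the node.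
[cite: Miller2011LMS, §1 and Def. 1.1] [cite: Cassels1965ArithmeticVIII] [cite: Darmon2004, Thm. 3.22] -/
theorem X3WildRankZero.bsdp_of_isIsogenous_of_unit_member (hS : X3PotGoodRankZeroUpperOfSmallClassTorsion)
    (hCassels : bsdRHS_eq_of_isIsogenous) (hGZK : rank_eq_analyticRank_of_analyticRank_le_one)
    (hmod : hasEntireLFunction_rat) (W₀ W : WeierstrassCurve ℚ) [W₀.IsElliptic] [W₀.IsGloballyMinimal]
    [W.IsElliptic] [W.IsGloballyMinimal] (hiso : IsIsogenous W₀ W) (p : ℕ) [Fact p.Prime] (hp : p ≠ 2)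
    (hg : ¬ W₀.HasGoodReductionAtPrime p) (hm : ¬ W₀.HasMultiplicativeReductionAtPrime p)
    (hj : 0 ≤ padicValRat p W₀.j) (hred : ¬ W₀.HasIrreducibleModPGaloisRep p) (hr : W₀.analyticRank = 0)
    (hsmall : ∀ (W' : WeierstrassCurve ℚ) [W'.IsElliptic], IsIsogenous W₀ W' → ¬ p ^ 2 ∣ W'.torsionOrder)
    {q₀ : ℚ} (hq₀ : shaAn W₀ = (q₀ : ℂ)) (hv : padicValRat p q₀ = 0) : BSDp W p := by
  have heven : ∀ q : ℚ, shaAn W₀ = (q : ℂ) → Even (padicValRat p q) := by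
    intro q hq
    have hqq : q = q₀ := by exact_mod_cast hq.symm.trans hq₀
    rw [hqq, hv]
    exact ⟨0, (add_zero 0).symm⟩
  have hu : MissingUpperBoundAt W₀ p := hS W₀ p hp hg hm hj hred hr hsmall heven
  have hr1 : W₀.analyticRank ≤ 1 := by rw [hr]; exact zero_le_one
  have hl : MissingLowerBoundAt W₀ p := ⟨q₀, hq₀, by rw [hv]; exact_mod_cast Nat.zero_le _⟩
  exact TwistComparison.bsdp_of_bsdp_of_isIsogenous W₀ W p hCassels hGZK hmod hiso hr1
    (bsdp_of_missingPPartAt W₀ p hGZK hr1 (missingPPartAt_of_lower_of_upper W₀ p hl hu))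

/-- **Full `BSD(W,p)` on the whole class from a finite LOWER certificate at one member (memo §2: the 144 all-`9 ∣ #Ш_an` classes,
census ask C-X3K-3 — o6-r2's side; socket `Typed/CasselsLowerBound`).**  If `W₀` satisfies the hypotheses of T-X3K♯ with
`ord_p #Ш_an(W₀)` even, `#Ш_an(W₀) = q₀` with `ord_p q₀ ≤ 2k`, and the certificate `p^{2k−1} ∣ #Ш(W₀)` holds (e.g. `(ℤ/p)ᵐ ↪ Ш(W₀)`
via `pow_dvd_shaOrder_of_injective`, `k = 1`: one nonzero `p`-torsion class), then `BSDp W p` for every globally minimal `W`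
isogenous to `W₀`: upper half T-X3K♯ (`hS`), lower half by Cassels–Tate squareness (`hCT`,
`missingLowerBoundAt_of_casselsTate_of_pow_dvd`), then Cassels transport.  Nothing is asserted about the node; the certificate
is per curve. [cite: SilvermanAEC2009, Thm. X.4.14] [cite: Miller2011LMS, §1 and Def. 1.1] [cite: Cassels1965ArithmeticVIII] -/
theorem X3WildRankZero.bsdp_of_isIsogenous_of_certificate (hS : X3PotGoodRankZeroUpperOfSmallClassTorsion)
    (hCassels : bsdRHS_eq_of_isIsogenous) (hCT : exists_casselsTate_pairing (K := ℚ))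
    (hGZK : rank_eq_analyticRank_of_analyticRank_le_one) (hmod : hasEntireLFunction_rat)
    (W₀ W : WeierstrassCurve ℚ) [W₀.IsElliptic] [W₀.IsGloballyMinimal] [W.IsElliptic] [W.IsGloballyMinimal]
    (hiso : IsIsogenous W₀ W) (p : ℕ) [Fact p.Prime] (hp : p ≠ 2)
    (hg : ¬ W₀.HasGoodReductionAtPrime p) (hm : ¬ W₀.HasMultiplicativeReductionAtPrime p)
    (hj : 0 ≤ padicValRat p W₀.j) (hred : ¬ W₀.HasIrreducibleModPGaloisRep p) (hr : W₀.analyticRank = 0)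
    (hsmall : ∀ (W' : WeierstrassCurve ℚ) [W'.IsElliptic], IsIsogenous W₀ W' → ¬ p ^ 2 ∣ W'.torsionOrder)
    (heven : ∀ q : ℚ, shaAn W₀ = (q : ℂ) → Even (padicValRat p q))
    {q₀ : ℚ} (hq₀ : shaAn W₀ = (q₀ : ℂ)) {k : ℕ} (hv : padicValRat p q₀ ≤ 2 * k)
    (hdvd : p ^ (2 * k - 1) ∣ W₀.shaOrder) : BSDp W p := by
  have hu : MissingUpperBoundAt W₀ p := hS W₀ p hp hg hm hj hred hr hsmall heven
  have hr1 : W₀.analyticRank ≤ 1 := by rw [hr]; exact zero_le_one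
  have hl : MissingLowerBoundAt W₀ p :=
    missingLowerBoundAt_of_casselsTate_of_pow_dvd W₀ p hCT (hGZK W₀ hr1).2 hq₀ hv hdvd
  exact TwistComparison.bsdp_of_bsdp_of_isIsogenous W₀ W p hCassels hGZK hmod hiso hr1
    (bsdp_of_missingPPartAt W₀ p hGZK hr1 (missingPPartAt_of_lower_of_upper W₀ p hl hu))

end Summit.BirchSwinnertonDyer.Rank1Residual.O6

end
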